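import Mathlib

/-!
# Character orthogonality on `(ℤ/2Nℤ)²` (stub `js_trigSum`)

Used by line `Sketch` (canonical-lift spine, seat c1) of the crux `CriticalTwoPointGSM`
(stmt-CriticalPhenomena-8365), through `js_cesaroIdentity`: for `N ≥ 1` and `u ∈ ℤ²`,

`∑_{j ∈ (-N,N]²} cos(π j·u / N) = (2N)²` if `2N ∣ u₁` and `2N ∣ u₂`, and `= 0` otherwise,

i.e. the orthogonality relations of the `(2N)²` characters `j ↦ exp(iπ j·u / N)` of `(ℤ/2Nℤ)²`
at the discrete momenta `k_j = πj/N`, `j ∈ (-N,N]²`.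

Proof: `cos(∑ᵢ θᵢ) = Re ∏ᵢ exp(iθᵢ)`; the sum over the box of the product is the product of the
one-dimensional sums (`Finset.sum_prod_piFinset`); and the one-dimensional full-period sum
`∑_{j ∈ (-N,N]} exp(iπju/N)` is `2N` if `2N ∣ u` (every term is `1`) and `0` otherwise
(the generator `ω = exp(iπu/N)` has `ω ≠ 1`, `ω^{2N} = 1`, and after reindexing `(-N,N]` by
`range (2N)` the sum is a constant times the vanishing geometric sum `∑_{m<2N} ω^m`).
Pure Mathlib; the characters are written inline (no auxiliary definitions); nothing else is in
this file.
-/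

noncomputable section

open MeasureTheory Filter Topology
open scoped BigOperators

namespace Summit.CriticalPhenomena.Ising3DConformalLimit.Theorems

namespace CriticalTwoPointGSMJs.JsTrigSum

/-- If `2N ∣ u`, every value `exp(iπju/N)` of the character is `1`. -/
lemma cexp_eq_one_of_dvd {N : ℕ} (hN : 1 ≤ N) {u : ℤ} (hu : (2 * (N : ℤ)) ∣ u) (j : ℤ) :
    Complex.exp (((Real.pi * (j : ℝ) * (u : ℝ) / N : ℝ) : ℂ) * Complex.I) = 1 := by
  obtain ⟨m, rfl⟩ := hu
  refine Complex.exp_eq_one_iff.mpr ⟨j * m, ?_⟩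
  have hN' : (N : ℂ) ≠ 0 := Nat.cast_ne_zero.mpr (by omega)
  push_cast
  field_simp

/-- The `2N`-th power of the generator `exp(iπu/N)` is `1`. -/
lemma cexp_gen_pow {N : ℕ} (hN : 1 ≤ N) (u : ℤ) :
    Complex.exp (((Real.pi * (u : ℝ) / N : ℝ) : ℂ) * Complex.I) ^ (2 * N) = 1 := by
  rw [← Complex.exp_nat_mul]
  refine Complex.exp_eq_one_iff.mpr ⟨u, ?_⟩
  have hN' : (N : ℂ) ≠ 0 := Nat.cast_ne_zero.mpr (by omega)
  push_cast
  field_simp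

/-- If `2N ∤ u`, the generator `exp(iπu/N)` is not `1`. -/
lemma cexp_gen_ne_one {N : ℕ} (hN : 1 ≤ N) {u : ℤ} (hu : ¬ (2 * (N : ℤ)) ∣ u) :
    Complex.exp (((Real.pi * (u : ℝ) / N : ℝ) : ℂ) * Complex.I) ≠ 1 := by
  intro h
  obtain ⟨n, hn⟩ := Complex.exp_eq_one_iff.mp h
  apply hu
  have hN' : (N : ℝ) ≠ 0 := Nat.cast_ne_zero.mpr (by omega)
  have h1 : ((Real.pi * (u : ℝ) / N : ℝ) : ℂ) = ((n * (2 * Real.pi) : ℝ) : ℂ) := by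
    apply mul_right_cancel₀ Complex.I_ne_zero
    rw [hn]
    push_cast
    ring
  have h2 : Real.pi * (u : ℝ) / N = n * (2 * Real.pi) := by exact_mod_cast h1
  rw [div_eq_iff hN'] at h2
  have h3 : (u : ℝ) = 2 * (N : ℝ) * (n : ℝ) := by
    apply mul_left_cancel₀ Real.pi_ne_zero
    linear_combination h2
  exact ⟨n, by exact_mod_cast h3⟩

/-- Reindexing the window `(-N, N]` of `ℤ` by `Finset.range (2N)` via `m ↦ -N + 1 + m`. -/
lemma sum_Ioc_eq_sum_range {M : Type*} [AddCommMonoid M] (N : ℕ) (f : ℤ → M) :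
    ∑ j ∈ Finset.Ioc (-(N : ℤ)) N, f j = ∑ m ∈ Finset.range (2 * N), f (-(N : ℤ) + 1 + m) := by
  rw [Int.Ioc_eq_finset_map, Finset.sum_map]
  have h : ((N : ℤ) - -(N : ℤ)).toNat = 2 * N := by omega
  rw [h]
  rfl

/-- Along the reindexed window the character is a constant times a geometric progression in the
generator: `exp(iπ(-N+1+m)u/N) = exp(iπ(-N+1)u/N) · exp(iπu/N)^m`. -/
lemma cexp_shift (N : ℕ) (u : ℤ) (m : ℕ) :
    Complex.exp (((Real.pi * ((-(N : ℤ) + 1 + m : ℤ) : ℝ) * (u : ℝ) / N : ℝ) : ℂ) * Complex.I) =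
      Complex.exp (((Real.pi * ((-(N : ℤ) + 1 : ℤ) : ℝ) * (u : ℝ) / N : ℝ) : ℂ) * Complex.I) *
        Complex.exp (((Real.pi * (u : ℝ) / N : ℝ) : ℂ) * Complex.I) ^ m := by
  rw [← Complex.exp_nat_mul, ← Complex.exp_add]
  congr 1
  push_cast
  ring

/-- **One-dimensional orthogonality.** For `N ≥ 1`,
`∑_{j ∈ (-N,N]} exp(iπju/N) = 2N` if `2N ∣ u`, and `= 0` otherwise. -/
lemma sum_cexp {N : ℕ} (hN : 1 ≤ N) (u : ℤ) :
    ∑ j ∈ Finset.Ioc (-(N : ℤ)) N,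
        Complex.exp (((Real.pi * (j : ℝ) * (u : ℝ) / N : ℝ) : ℂ) * Complex.I) =
      if (2 * (N : ℤ)) ∣ u then 2 * (N : ℂ) else 0 := by
  split_ifs with hu
  · rw [Finset.sum_congr rfl fun j _ => cexp_eq_one_of_dvd hN hu j, Finset.sum_const,
      Int.card_Ioc, nsmul_eq_mul, mul_one]
    have h : ((N : ℤ) - -(N : ℤ)).toNat = 2 * N := by omega
    rw [h]
    push_cast
    ring
  · rw [sum_Ioc_eq_sum_range N fun j =>
        Complex.exp (((Real.pi * (j : ℝ) * (u : ℝ) / N : ℝ) : ℂ) * Complex.I),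
      Finset.sum_congr rfl fun m _ => cexp_shift N u m, ← Finset.mul_sum,
      geom_sum_eq (cexp_gen_ne_one hN hu), cexp_gen_pow hN, sub_self, zero_div, mul_zero]

/-- Each box cosine is the real part of the product of the one-dimensional characters. -/
lemma cos_sum_eq_re_prod (N : ℕ) (u j : Fin 2 → ℤ) :
    Real.cos (∑ i : Fin 2, Real.pi * (j i : ℝ) * (u i : ℝ) / N) =
      (∏ i : Fin 2,
        Complex.exp (((Real.pi * (j i : ℝ) * (u i : ℝ) / N : ℝ) : ℂ) * Complex.I)).re := by
  rw [← Complex.exp_ofReal_mul_I_re]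
  congr 1
  rw [← Complex.exp_sum]
  congr 1
  push_cast
  rw [Finset.sum_mul]

/-- Swapping the sum over the box `(-N,N]²` with the product over the two coordinates
(`Finset.sum_prod_piFinset`). -/
lemma sum_box_prod (N : ℕ) (u : Fin 2 → ℤ) :
    ∑ j ∈ Fintype.piFinset (fun _ : Fin 2 => Finset.Ioc (-(N : ℤ)) N),
        ∏ i : Fin 2, Complex.exp (((Real.pi * (j i : ℝ) * (u i : ℝ) / N : ℝ) : ℂ) * Complex.I) =
      ∏ i : Fin 2, ∑ x ∈ Finset.Ioc (-(N : ℤ)) N,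
        Complex.exp (((Real.pi * (x : ℝ) * (u i : ℝ) / N : ℝ) : ℂ) * Complex.I) :=
  Finset.sum_prod_piFinset _ fun (i : Fin 2) (x : ℤ) =>
    Complex.exp (((Real.pi * (x : ℝ) * (u i : ℝ) / N : ℝ) : ℂ) * Complex.I)

end CriticalTwoPointGSMJs.JsTrigSum

open CriticalTwoPointGSMJs.JsTrigSum in
/-- **Character orthogonality on `(ℤ/2Nℤ)²` (stub `js_trigSum`).** For `N ≥ 1` and `u ∈ ℤ²`,
`∑_{j ∈ (-N,N]²} cos(π j·u / N) = (2N)²` if `2N ∣ u₁` and `2N ∣ u₂`, and `= 0` otherwise.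
Proof: `cos(∑ θᵢ) = Re ∏ exp(iθᵢ)`, swap sum and product over the box
(`Finset.sum_prod_piFinset`), and evaluate the one-dimensional full-period geometric sums
(`CriticalTwoPointGSMJs.JsTrigSum.sum_cexp`). -/
theorem js_trigSum : ∀ N : ℕ, 1 ≤ N → ∀ u : Fin 2 → ℤ,
    ∑ j ∈ Fintype.piFinset (fun _ : Fin 2 => Finset.Ioc (-(N : ℤ)) N),
        Real.cos (∑ i : Fin 2, Real.pi * (j i : ℝ) * (u i : ℝ) / N) =
      if (∀ i : Fin 2, (2 * (N : ℤ)) ∣ u i) then (2 * (N : ℝ)) ^ 2 else 0 := by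
  intro N hN u
  rw [Finset.sum_congr rfl fun j _ => cos_sum_eq_re_prod N u j, ← Complex.re_sum, sum_box_prod,
    Finset.prod_congr rfl fun i _ => sum_cexp hN (u i)]
  split_ifs with hall
  · rw [Finset.prod_congr rfl fun i _ => if_pos (hall i), Finset.prod_const, Finset.card_univ,
      Fintype.card_fin]
    have h : (2 * (N : ℂ)) ^ 2 = (((2 * (N : ℝ)) ^ 2 : ℝ) : ℂ) := by push_cast; ring
    rw [h, Complex.ofReal_re]
  · push Not at hall
    obtain ⟨i, hi⟩ := hall
    rw [Finset.prod_eq_zero (Finset.mem_univ i) (if_neg hi), Complex.zero_re]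

end Summit.CriticalPhenomena.Ising3DConformalLimit.Theorems

end
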